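import Mathlib
import Summits.Ventures.PercRepro.TriangleCapStarFamilyListWitness

/-!
# PercRepro — TWO BELOW THE THRESHOLD IN THE UPPER REGIME `D < 2 r`: THE THREE-SHORT STAR FAMILY (p3, gen 57;
part 351)

`D + 3 ≤ 2 r`, `r + 2 ≤ D`, `ρ = D − r`, `X = D − 2 ρ ≥ 3`, `m = D + r − 4` (two below the threshold `m ≥ D + r − 2`
of part 319), `t = m D + r`: the short-list star family of part 350 with `a = ρ` specials, `Rc = r` centre rows, the
first three short — two rows `{centre}` and one of size `X − 2` (`sh = (D − 1, D − 1, 2 ρ + 2, 0, …)`), `Q = 2 r − 4`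
regular columns and no extra row is a graph of the band with
`2 j + 2 t (D − 1) = t (t − 1) + 2 ρ + 2 (D − 1) + (D − 2 ρ − 2)(2 ρ + 2) = t (t − 1) + 2 ρ (X + 1) + (4 X − 6)`
(`upper_zone_two_below_witness`: `I = ρ`, every column full, `m + 3` active rows).  It is below the bipartite value
`2 r (D − r) = 2 ρ (X + 1) + 2 ρ (ρ − 1)` iff `4 X − 6 < 2 ρ (ρ − 1)` (`(D, r, m) = (9, 6, 11)`: `30 < 36`;
`(12, 8, 16)`: `50 < 64`); the relaxation of mining/p3/g57/refinedK.py meets it at `(9, 6)` and `(11, 7)` and stays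
below it at `(10, 7)` (`38 ≤ bottom ≤ 40`) — the exact bottom two below is OPEN.  Axioms: standard.
-/

namespace PercRepro

namespace TriangleCap

namespace C047

open Finset

/-- The short list of the three-short family: `D − 1, D − 1, 2 ρ + 2`, then `0`. -/
def shThree (D r ρ : ℕ) : ℕ := if ρ = 0 then D - 1 else if ρ = 1 then D - 1 else if ρ = 2 then 2 * (D - r) + 2 else 0

/-- The sum of the short list over `range r`, `3 ≤ r`: `2 (D − 1) + 2 (D − r) + 2`. -/
theorem sum_shThree (D r : ℕ) (hr : 3 ≤ r) : ∑ ρ ∈ range r, shThree D r ρ = 2 * (D - 1) + (2 * (D - r) + 2) := by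
  rw [← sum_subset (range_subset_range.mpr hr) (fun ρ _ hρ => by
    rw [mem_range, not_lt] at hρ
    unfold shThree
    rw [if_neg (by omega), if_neg (by omega), if_neg (by omega)])]
  rw [sum_range_succ, sum_range_succ, sum_range_succ, sum_range_zero]
  unfold shThree
  simp only [Nat.one_ne_zero, ↓reduceIte, zero_add, show (2 : ℕ) ≠ 0 by omega, show (2 : ℕ) ≠ 1 by omega]
  ring

/-- The deficiency of the short list over `range r`, `3 ≤ r`, `2 (D − r) + 2 ≤ D`:
`2 (D − 1) + (D − (2 (D − r) + 2)) (2 (D − r) + 2)`. -/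
theorem sum_def_shThree (D r : ℕ) (hr : 3 ≤ r) :
    ∑ ρ ∈ range r, (D - shThree D r ρ) * shThree D r ρ =
      2 * ((D - (D - 1)) * (D - 1)) + (D - (2 * (D - r) + 2)) * (2 * (D - r) + 2) := by
  rw [← sum_subset (range_subset_range.mpr hr) (fun ρ _ hρ => by
    rw [mem_range, not_lt] at hρ
    unfold shThree
    rw [if_neg (by omega), if_neg (by omega), if_neg (by omega), mul_zero])]
  rw [sum_range_succ, sum_range_succ, sum_range_succ, sum_range_zero]
  unfold shThree
  simp only [Nat.one_ne_zero, ↓reduceIte, zero_add, show (2 : ℕ) ≠ 0 by omega, show (2 : ℕ) ≠ 1 by omega]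
  ring

/-- The value identity: `2 ρ + (2 (D − 1) + (D − 2 ρ − 2)(2 ρ + 2)) = 2 ρ (X + 1) + (4 X − 6)`, `ρ = D − r`,
`X = D − 2 ρ = 2 r − D ≥ 3`. -/
theorem two_below_upper_value_arith (D r : ℕ) (h1 : D + 3 ≤ 2 * r) (h2 : r + 2 ≤ D) :
    2 * (D - r) + ((r + (D - r)) * (D - (r + (D - r))) +
      (2 * ((D - (D - 1)) * (D - 1)) + (D - (2 * (D - r) + 2)) * (2 * (D - r) + 2))) =
      2 * ((D - r) * (D - 2 * (D - r) + 1)) + (4 * (D - 2 * (D - r)) - 6) := by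
  obtain ⟨ρ, rfl⟩ : ∃ ρ, D = r + ρ := ⟨D - r, by omega⟩
  obtain ⟨X, rfl⟩ : ∃ X, r = ρ + X + 3 := ⟨r - ρ - 3, by omega⟩
  have e1 : ρ + X + 3 + ρ - (ρ + X + 3) = ρ := by omega
  have e2 : ρ + X + 3 + ρ - (ρ + X + 3 + ρ) = 0 := by omega
  have e3 : ρ + X + 3 + ρ - (ρ + X + 3 + ρ - 1) = 1 := by omega
  have e4 : ρ + X + 3 + ρ - 1 = 2 * ρ + X + 2 := by omega
  have e5 : ρ + X + 3 + ρ - (2 * ρ + 2) = X + 1 := by omega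
  have e6 : ρ + X + 3 + ρ - 2 * ρ + 1 = X + 4 := by omega
  have e7 : 4 * (ρ + X + 3 + ρ - 2 * ρ) - 6 = 4 * X + 6 := by omega
  rw [e1, e2, e3, e4, e5, e6, e7]
  ring

/-- **TWO BELOW THE THRESHOLD, UPPER REGIME — THE WITNESS:** for `D + 3 ≤ 2 r`, `r + 2 ≤ D`, `m + 4 = D + r`,
`t = m D + r`, `m + 1 ≤ ℓ`, `2 t ≤ s`: a triangle-free graph on `ℓ + 1 + (s − t)` vertices with `s` edges, a vertex
`w` of degree `s − t`, every off-degree `≤ D`, a non-neighbour of off-degree exactly `D`, and the band value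
`2 j + 2 t (D − 1) = t (t − 1) + 2 ρ (D − 2 ρ + 1) + (4 (D − 2 ρ) − 6)`, `ρ = D − r`. -/
theorem upper_zone_two_below_witness (s ℓ m r D : ℕ) (h1 : D + 3 ≤ 2 * r) (h2 : r + 2 ≤ D) (hm : m + 4 = D + r)
    (hmℓ : m + 1 ≤ ℓ) (hs : 2 * (m * D + r) ≤ s) :
    ∃ (H : SimpleGraph (Fin (ℓ + 1 + (s - (m * D + r))))) (_ : DecidableRel H.Adj), H.CliqueFree 3 ∧
      H.edgeFinset.card = s ∧ ∃ w, deg H w + (m * D + r) = s ∧ (∀ v, offDeg H w v ≤ D) ∧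
        (∃ x, ¬ H.Adj w x ∧ offDeg H w x = D) ∧
        ∃ j, ∑ v, deg H v * deg H v + 2 * ((m * D + r) * (s - (m * D + r) - 1)) + 2 * j = s * (s + 1) ∧
          2 * j + 2 * ((m * D + r) * (D - 1)) = (m * D + r) * (m * D + r - 1) +
            (2 * ((D - r) * (D - 2 * (D - r) + 1)) + (4 * (D - 2 * (D - r)) - 6)) := by
  have hr3 : 3 ≤ r := by omega
  have ht : m * D + r = r + (D - r) * (D - 1) + (2 * r - 4) * D + (D - r) := by
    obtain ⟨ρ, rfl⟩ : ∃ ρ, D = r + ρ := ⟨D - r, by omega⟩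
    obtain ⟨r', rfl⟩ : ∃ r', r = r' + 4 := ⟨r - 4, by omega⟩
    have hm' : m = r' + 4 + ρ + r' := by omega
    subst hm'
    have e1 : r' + 4 + ρ - (r' + 4) = ρ := by omega
    have e2 : r' + 4 + ρ - 1 = r' + ρ + 3 := by omega
    have e3 : 2 * (r' + 4) - 4 = 2 * r' + 4 := by omega
    rw [e1, e2, e3]
    ring
  have hinc : r * (D - 1) + (D - 1) * (D - (D - r)) + 0 * D = (2 * r - 4) * D + ∑ ρ ∈ range r, shThree D r ρ := by
    rw [sum_shThree D r hr3]
    obtain ⟨ρ, rfl⟩ : ∃ ρ, D = r + ρ := ⟨D - r, by omega⟩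
    obtain ⟨r', rfl⟩ : ∃ r', r = r' + 4 := ⟨r - 4, by omega⟩
    have e1 : r' + 4 + ρ - (r' + 4) = ρ := by omega
    have e2 : r' + 4 + ρ - 1 = r' + ρ + 3 := by omega
    have e3 : 2 * (r' + 4) - 4 = 2 * r' + 4 := by omega
    have e4 : r' + 4 + ρ - ρ = r' + 4 := by omega
    rw [e1, e2, e3, e4]
    ring
  have hsh : ∀ ρ < r, shThree D r ρ + 1 ≤ D := by
    intro ρ _
    unfold shThree
    split_ifs <;> omega
  obtain ⟨H, inst, hfree, hcard, w, hw, hD', hx, j, hj, hval⟩ :=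
    starFamilyListWitness s ℓ (m * D + r) D (D - r) r (shThree D r) 0 (2 * r - 4) ht (by omega) (by omega)
      (by omega) hsh (by omega) (by omega) (fun h => by omega) hinc (by omega) hs
  refine ⟨H, inst, hfree, hcard, w, hw, hD', hx, j, hj, ?_⟩
  rw [hval, sum_def_shThree D r hr3]
  have harith := two_below_upper_value_arith D r h1 h2
  omega

end C047

end TriangleCap

end PercRepro
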